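import Literature.AlgebraicGeometry.HodgeTheory.QuaternionicQuarticDeckChartEtale
import HarnessLib

/-!
# The étale chart of the normalised quaternionic quartic cover IS standard étale — the equivalence and its
# consequences (programme «M1», brick M1-0a′, part 2)

Layer `Literature/AlgebraicGeometry/HodgeTheory`. Definitions + proved API (no named fact). Written by the prover
seat `hodge-nonav-prover-Bx` (g19, cell `hodge-nonav`), programme M1 (memo `PROGRAMME-M1-Bx-g19.md`) for route
`HodgeConjecture/Q8SymplecticPowers` (crux K1Q, stmt-HodgeConjecture-24190). Sequel of
`QuaternionicQuarticDeckChartEtale` (the standard étale pair `(X⁴ − g, h)` over `R₀ = R[u₀, u₁]` and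
`Ψ = deckLift : R₀[X][Y]/(X⁴ − g, Yh − 1) → DeckRing a`, `X ↦ w`, `Y ↦ v`). Here:

* `deckToPair` — the inverse `Φ` (`w ↦ X`, `w₁ ↦ c Y X²`, `w₂ ↦ c² α ψ Y² X³`, `v ↦ Y`; the seven relations die in the
  standard étale algebra by explicit certificates in `X⁴ = g` and `hY = 1`);
* **`deckRingEquivPair : DeckRing a ≃ₐ[R₀] R₀[X][Y]/(X⁴ − g, Yh − 1)`** and **`etale_deckRing`** (the chart is étale
  over the `(u₀, u₁)`-plane, Stacks 00UB);
* over a field `K ⊇ ℂ`: **`isRegularRing_deckRing`** (étale over the regular `K[u₀, u₁]`, Stacks 00TV via the tree's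
  `IsRegularLocalRing.of_etale`) and **`isDomain_deckRing_of_prime`** (a domain as soon as `X⁴ − g` is prime in
  `K[u₀, u₁][X]` and `h ≠ 0`; `R₀[X][Y]/(f, Yh − 1) ≅ (R₀[X]/f)[1/h]`).

The `R₀`-algebra structure on `DeckRing a` is the `def` `baseAlgebra a` of the prequel, used as a LOCAL instance;
the exported regularity / integrality statements are instance-free. Honest scope: explicit commutative algebra for
one family of surfaces; nothing here bears on HC.

## References

* [StacksProject] The Stacks Project, Tag 00UB (standard étale algebras), Tag 00TV (étale over regular).
* [Kollar2007] J. Kollár, Lectures on Resolution of Singularities (2007), §3.3, §3.4.1.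
-/

noncomputable section

open MvPolynomial

namespace Literature.AlgebraicGeometry.HodgeTheory.Q8Family

universe v

section Pair

variable {R : Type v} [CommRing R] [Algebra ℂ R] {e : ℕ} (a : CIdx e → R)

attribute [local instance] baseAlgebra isScalarTower_base

/-- The images of the six chart generators in the standard étale algebra:
`(u₀, u₁, X, c Y X², c² α ψ Y² X³, Y)`. [cite: StacksProject, Tag 00UB] -/
def pairGens : Fin 6 → (deckPair a).Ring :=
  ![algebraMap _ _ (X 0 : MvPolynomial (Fin 2) R), algebraMap _ _ (X 1 : MvPolynomial (Fin 2) R), (deckPair a).X,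
    algebraMap _ _ (c₂ a) * pairY a * (deckPair a).X ^ 2,
    algebraMap _ _ (c₂ a ^ 2 * α₂ * ψ₂ a) * pairY a ^ 2 * (deckPair a).X ^ 3, pairY a]

/-- The scalars `R → R₀ → R₀[X][Y]/(f, Yh − 1)`. [cite: StacksProject, Tag 00UB] -/
def pairScalar : R →+* (deckPair a).Ring :=
  (algebraMap (MvPolynomial (Fin 2) R) (deckPair a).Ring).comp (algebraMap R (MvPolynomial (Fin 2) R))

/-- `Φ₀ : R[u₀, u₁, w, w₁, w₂, v] → R₀[X][Y]/(f, Yh − 1)` on the polynomial ring. [cite: StacksProject, Tag 00UB] -/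
def deckToPairPoly : MvPolynomial (Fin 6) R →+* (deckPair a).Ring :=
  eval₂Hom (pairScalar a) (pairGens a)

/-- `Φ₀` on a generator. [cite: StacksProject, Tag 00UB] -/
@[simp] theorem deckToPairPoly_X (i : Fin 6) : deckToPairPoly a (X i) = pairGens a i :=
  eval₂Hom_X' _ _ _

/-- `Φ₀ ∘ toSix` is the structure map of `R₀` (as ring maps). [cite: StacksProject, Tag 00UB] -/
theorem deckToPairPoly_comp_toSix :
    (deckToPairPoly a).comp (toSix (R := R)).toRingHom = algebraMap (MvPolynomial (Fin 2) R) (deckPair a).Ring := by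
  refine MvPolynomial.ringHom_ext (fun r => ?_) (fun i => ?_)
  · rw [RingHom.comp_apply, AlgHom.toRingHom_eq_coe, AlgHom.coe_toRingHom, algHom_C, MvPolynomial.algebraMap_eq,
      deckToPairPoly, eval₂Hom_C]
    simp only [pairScalar, RingHom.comp_apply, MvPolynomial.algebraMap_eq]
  · rw [RingHom.comp_apply, AlgHom.toRingHom_eq_coe, AlgHom.coe_toRingHom]
    fin_cases i
    · change deckToPairPoly a (toSix (X 0)) = algebraMap _ _ (X 0)
      rw [toSix_X0, deckToPairPoly_X]; rfl
    · change deckToPairPoly a (toSix (X 1)) = algebraMap _ _ (X 1)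
      rw [toSix_X1, deckToPairPoly_X]; rfl

/-- `Φ₀ ∘ toSix` is the structure map of `R₀`. [cite: StacksProject, Tag 00UB] -/
theorem deckToPairPoly_toSix (p : MvPolynomial (Fin 2) R) :
    deckToPairPoly a (toSix p) = algebraMap (MvPolynomial (Fin 2) R) (deckPair a).Ring p := by
  have h := DFunLike.congr_fun (deckToPairPoly_comp_toSix a) p
  rwa [RingHom.comp_apply, AlgHom.toRingHom_eq_coe, AlgHom.coe_toRingHom] at h

/-- `Φ₀` kills every relation. [cite: StacksProject, Tag 00UB] -/
theorem deckToPairPoly_rel (k : Fin 7) : deckToPairPoly a (rel a k) = 0 := by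
  have F1 := pairX_pow_four a
  have F2 := algebraMap_h₂_mul_pairY a
  simp only [g₂, map_mul, map_pow] at F1
  simp only [h₂, map_mul] at F2
  set x := (deckPair a).X
  set y := pairY a
  set C := algebraMap (MvPolynomial (Fin 2) R) (deckPair a).Ring (c₂ a)
  set C' := algebraMap (MvPolynomial (Fin 2) R) (deckPair a).Ring (c₂' a)
  set A := algebraMap (MvPolynomial (Fin 2) R) (deckPair a).Ring α₂
  set S := algebraMap (MvPolynomial (Fin 2) R) (deckPair a).Ring (ψ₂ a)
  have hc : deckToPairPoly a (cU a) = C := by rw [← toSix_c₂, deckToPairPoly_toSix]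
  have hc' : deckToPairPoly a (cU' a) = C' := by rw [← toSix_c₂', deckToPairPoly_toSix]
  have hα : deckToPairPoly a (αU : MvPolynomial (Fin 6) R) = A := by rw [← toSix_α₂, deckToPairPoly_toSix]
  have hψ : deckToPairPoly a (ψU a) = S := by rw [← toSix_ψ₂, deckToPairPoly_toSix]
  have hh : deckToPairPoly a (hU a) = C * C' * A * S := by simp only [hU, map_mul, hc, hc', hα, hψ]
  have h2 : deckToPairPoly a (X 2) = x := deckToPairPoly_X a 2
  have h3 : deckToPairPoly a (X 3) = C * y * x ^ 2 := deckToPairPoly_X a 3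
  have h4 : deckToPairPoly a (X 4) = C ^ 2 * A * S * y ^ 2 * x ^ 3 := by
    rw [deckToPairPoly_X]
    change algebraMap _ _ (c₂ a ^ 2 * α₂ * ψ₂ a) * y ^ 2 * x ^ 3 = _
    rw [map_mul, map_mul, map_pow]
  have h5 : deckToPairPoly a (X 5) = y := deckToPairPoly_X a 5
  fin_cases k
  · simp only [rel, map_sub, map_pow, map_mul, h3, hc, hc']
    linear_combination (C ^ 2 * y ^ 2) * F1 + (C * C' * (C * C' * A * S * y + 1)) * F2
  · simp only [rel, map_sub, map_pow, map_mul, h2, h3, hc', hα, hψ]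
    linear_combination (-(x ^ 2)) * F2
  · simp only [rel, map_sub, map_pow, map_mul, h4, h3, hc, hα, hψ]
    linear_combination (C ^ 4 * A ^ 2 * S ^ 2 * y ^ 4 * x ^ 2) * F1
      + (C ^ 2 * A * S * y * x ^ 2 * ((C * C' * A * S * y) ^ 2 + C * C' * A * S * y + 1)) * F2
  · simp only [rel, map_sub, map_mul, h2, h3, h4, hc']
    linear_combination (-(C * y * x ^ 3)) * F2
  · simp only [rel, map_sub, map_mul, h3, h4, h2, hc]
    linear_combination (C ^ 3 * A * S * y ^ 3 * x) * F1 + (C * x * ((C * C' * A * S * y) ^ 2 + C * C' * A * S * y + 1)) * F2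
  · simp only [rel, map_sub, map_mul, h2, h4, hh]
    linear_combination (C ^ 2 * A * S * y ^ 2) * F1 + (C * C' * A * S * (C * C' * A * S * y + 1)) * F2
  · simp only [rel, map_sub, map_mul, map_one, h5, hh]
    linear_combination F2

/-- The ideal of relations lies in the kernel of `Φ₀`. [cite: StacksProject, Tag 00UB] -/
theorem deckIdeal_le_ker_deckToPairPoly : deckIdeal a ≤ RingHom.ker (deckToPairPoly a) := by
  rw [deckIdeal, Ideal.span_le]
  rintro _ ⟨k, rfl⟩
  exact deckToPairPoly_rel a k

/-- `Φ : DeckRing a → R₀[X][Y]/(f, Yh − 1)` as a ring map. [cite: StacksProject, Tag 00UB] -/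
def deckToPairR : DeckRing a →+* (deckPair a).Ring :=
  Ideal.Quotient.lift (deckIdeal a) (deckToPairPoly a) (fun _ hx => deckIdeal_le_ker_deckToPairPoly a hx)

/-- `Φ` on classes. [cite: StacksProject, Tag 00UB] -/
@[simp] theorem deckToPairR_mk (p : MvPolynomial (Fin 6) R) :
    deckToPairR a (Ideal.Quotient.mk (deckIdeal a) p) = deckToPairPoly a p := rfl

/-- **`Φ : DeckRing a → R₀[X][Y]/(f, Yh − 1)`** as an `R₀`-algebra map (`w ↦ X`, `w₁ ↦ c Y X²`, `w₂ ↦ c² α ψ Y² X³`,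
`v ↦ Y`). [cite: StacksProject, Tag 00UB] -/
def deckToPair : DeckRing a →ₐ[MvPolynomial (Fin 2) R] (deckPair a).Ring :=
  { deckToPairR a with
    commutes' := fun p => by
      change deckToPairR a (algebraMap _ (DeckRing a) p) = _
      rw [algebraMap_base_apply, deckToPairR_mk, deckToPairPoly_toSix] }

/-- `Φ` on classes. [cite: StacksProject, Tag 00UB] -/
@[simp] theorem deckToPair_mk (p : MvPolynomial (Fin 6) R) :
    deckToPair a (Ideal.Quotient.mk (deckIdeal a) p) = deckToPairPoly a p := rfl

/-- `Φ ∘ Ψ = id` (both fix `X`). [cite: StacksProject, Tag 00UB] -/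
theorem deckToPair_comp_deckLift : (deckToPair a).comp (deckLift a) = AlgHom.id _ _ :=
  StandardEtalePair.hom_ext (by
    rw [AlgHom.comp_apply, deckLift_X, deckToPair_mk, AlgHom.id_apply, deckToPairPoly_X]
    rfl)

/-- `Ψ ∘ Φ = id` (checked on the six generators, using `w₁ = c v w²`, `w₂ = c² α ψ v² w³` in `DeckRing a`).
[cite: StacksProject, Tag 00UB] -/
theorem deckLift_comp_deckToPair : (deckLift a).comp (deckToPair a) = AlgHom.id _ _ := by
  have hu : ∀ p : MvPolynomial (Fin 2) R, deckLift a (algebraMap _ (deckPair a).Ring p) =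
      Ideal.Quotient.mk (deckIdeal a) (toSix p) := fun p => by
    rw [AlgHom.commutes, algebraMap_base_apply]
  have key : ((deckLift a).comp (deckToPair a) : DeckRing a →+* DeckRing a).comp (Ideal.Quotient.mk (deckIdeal a)) =
      (AlgHom.id (MvPolynomial (Fin 2) R) (DeckRing a) : DeckRing a →+* DeckRing a).comp
        (Ideal.Quotient.mk (deckIdeal a)) := by
    refine MvPolynomial.ringHom_ext (fun r => ?_) (fun i => ?_)
    · change deckLift a (deckToPair a (Ideal.Quotient.mk (deckIdeal a) (C r))) = Ideal.Quotient.mk (deckIdeal a) (C r)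
      rw [deckToPair_mk, deckToPairPoly, eval₂Hom_C]
      change deckLift a (algebraMap _ (deckPair a).Ring (algebraMap R (MvPolynomial (Fin 2) R) r)) = _
      rw [hu, MvPolynomial.algebraMap_eq, algHom_C, MvPolynomial.algebraMap_eq]
    · fin_cases i
      · change deckLift a (deckToPair a (Ideal.Quotient.mk (deckIdeal a) (X 0))) = Ideal.Quotient.mk (deckIdeal a) (X 0)
        rw [deckToPair_mk, deckToPairPoly_X]
        change deckLift a (algebraMap _ _ (X 0)) = _
        rw [hu, toSix_X0]
      · change deckLift a (deckToPair a (Ideal.Quotient.mk (deckIdeal a) (X 1))) = Ideal.Quotient.mk (deckIdeal a) (X 1)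
        rw [deckToPair_mk, deckToPairPoly_X]
        change deckLift a (algebraMap _ _ (X 1)) = _
        rw [hu, toSix_X1]
      · change deckLift a (deckToPair a (Ideal.Quotient.mk (deckIdeal a) (X 2))) = Ideal.Quotient.mk (deckIdeal a) (X 2)
        rw [deckToPair_mk, deckToPairPoly_X]
        exact deckLift_X a
      · change deckLift a (deckToPair a (Ideal.Quotient.mk (deckIdeal a) (X 3))) = Ideal.Quotient.mk (deckIdeal a) (X 3)
        rw [deckToPair_mk, deckToPairPoly_X]
        change deckLift a (algebraMap _ _ (c₂ a) * pairY a * (deckPair a).X ^ 2) = _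
        rw [map_mul, map_mul, map_pow, hu, toSix_c₂, deckLift_pairY, deckLift_X, mk_X3_eq, map_mul, map_mul, map_pow]
      · change deckLift a (deckToPair a (Ideal.Quotient.mk (deckIdeal a) (X 4))) = Ideal.Quotient.mk (deckIdeal a) (X 4)
        rw [deckToPair_mk, deckToPairPoly_X]
        change deckLift a (algebraMap _ _ (c₂ a ^ 2 * α₂ * ψ₂ a) * pairY a ^ 2 * (deckPair a).X ^ 3) = _
        rw [map_mul, map_mul, map_pow, map_pow, hu, deckLift_pairY, deckLift_X, mk_X4_eq]
        simp only [map_mul, map_pow, toSix_c₂, toSix_α₂, toSix_ψ₂]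
      · change deckLift a (deckToPair a (Ideal.Quotient.mk (deckIdeal a) (X 5))) = Ideal.Quotient.mk (deckIdeal a) (X 5)
        rw [deckToPair_mk, deckToPairPoly_X]
        exact deckLift_pairY a
  apply AlgHom.coe_ringHom_injective
  exact Ideal.Quotient.ringHom_ext key

/-- **The chart ring is the standard étale algebra**: `DeckRing a ≃ₐ[R₀] R₀[X][Y]/(X⁴ − g, Y h − 1)`.
[cite: StacksProject, Tag 00UB] -/
def deckRingEquivPair : DeckRing a ≃ₐ[MvPolynomial (Fin 2) R] (deckPair a).Ring :=
  AlgEquiv.ofAlgHom (deckToPair a) (deckLift a) (deckToPair_comp_deckLift a) (deckLift_comp_deckToPair a)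

/-- **The chart is étale over the `(u₀, u₁)`-plane** (for the `R₀`-algebra structure `baseAlgebra`).
[cite: StacksProject, Tag 00UB] -/
theorem etale_deckRing : Algebra.Etale (MvPolynomial (Fin 2) R) (DeckRing a) :=
  Algebra.Etale.of_equiv (deckRingEquivPair a).symm

end Pair

/-! ### Consequences over a field: regularity, integrality -/

section Field

variable {K : Type v} [Field K] [Algebra ℂ K] {e : ℕ} (a : CIdx e → K)

attribute [local instance] baseAlgebra isScalarTower_base

/-- **The chart ring over a field is a regular ring** (étale over the regular ring `K[u₀, u₁]`:
Stacks 00TV via the tree's `IsRegularLocalRing.of_etale`). [cite: StacksProject, Tag 00TV] -/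
theorem isRegularRing_deckRing : IsRegularRing (DeckRing a) := by
  haveI : Algebra.Etale (MvPolynomial (Fin 2) K) (DeckRing a) := etale_deckRing a
  haveI : IsNoetherianRing (DeckRing a) := Algebra.FiniteType.isNoetherianRing (MvPolynomial (Fin 2) K) _
  refine isRegularRing_iff.mpr fun q hq => ?_
  exact Literature.AlgebraicGeometry.Motives.IsRegularLocalRing.of_etale (R := MvPolynomial (Fin 2) K) q

/-- **The chart ring over a field is a domain as soon as `X⁴ − g` is prime in `K[u₀, u₁][X]` and `h ≠ 0`**
(`R₀[X][Y]/(f, Yh − 1) ≅ (R₀[X]/f)[1/h]`, Mathlib `StandardEtalePair.equivAwayAdjoinRoot`).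
[cite: StacksProject, Tag 00UB] -/
theorem isDomain_deckRing_of_prime (hf : Prime (Polynomial.X ^ 4 - Polynomial.C (g₂ a)))
    (hh : h₂ a ≠ 0) : IsDomain (DeckRing a) := by
  haveI : IsDomain (AdjoinRoot (deckPair a).f) := AdjoinRoot.isDomain_of_prime (by rw [deckPair_f]; exact hf)
  have hne : AdjoinRoot.mk (deckPair a).f (deckPair a).g ≠ 0 := by
    rw [Ne, AdjoinRoot.mk_eq_zero, deckPair_f, deckPair_g]
    intro hdvd
    have hdeg := Polynomial.degree_le_of_dvd hdvd (by rw [Ne, Polynomial.C_eq_zero]; exact hh)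
    rw [Polynomial.degree_C hh, Polynomial.degree_X_pow_sub_C (by norm_num)] at hdeg
    exact absurd hdeg (by norm_num)
  haveI : IsDomain (Localization.Away (AdjoinRoot.mk (deckPair a).f (deckPair a).g)) :=
    IsLocalization.isDomain_localization
      (powers_le_nonZeroDivisors_of_noZeroDivisors hne)
  exact ((deckRingEquivPair a).trans (deckPair a).equivAwayAdjoinRoot).toMulEquiv.isDomain

end Field

end Literature.AlgebraicGeometry.HodgeTheory.Q8Family

end
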